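import Mathlib.Analysis.InnerProductSpace.Basic
import Mathlib.Analysis.SpecialFunctions.Trigonometric.Deriv
import HarnessLib

/-!
# Crux `BlockLipschitzL` (stmt-QuantumFields-23533) ∕ `HistoryTailL` (stmt-QuantumFields-19936), LINE 25 «CompactnessTransfer»,
# K2 continuum face, row (RS) `MinimisingMapSmoothness` — FILE (RS-0)-letters «THE PLANE ROTATION `R(θ) = 1 + sin θ·J + (cos θ − 1)·P`»

Cell `ym3-torus` (YM ladder rung R3 = continuum SU(2) Yang–Mills on T³ — a RUNG, NOT the Clay problem: not d = 4, not
infinite volume, not a mass gap); WIDTH helper seat `ym-ust-19936-w7` g14.  Helper `--supports stmt-QuantumFields-23533`;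
THEOREMS ONLY (0 `def`, 0 `sorry`, default heartbeats); Mathlib only.

THE LETTERS of FILE (RS-0) ✓`PoincareLipschitzMinimiserWeaklyHarmonic` («ball minimisers into a sphere are weakly harmonic»):
for an orthonormal pair `p, q` of a real inner-product space `F` the plane maps `J z := ⟪p,z⟫q − ⟪q,z⟫p` (generator) and
`P z := ⟪p,z⟫p + ⟪q,z⟫q` (projection) — carried as continuous-linear-map VARIABLES with defining rows `hJ`, `hP` — and
the rotation `R(θ) := 1 + sin θ·J + (cos θ − 1)·P` by the angle `θ` in the `(p,q)`-plane (identity on its orthocomplement):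
* §1 `J_J_eq_neg_P` (`J² = −P`), `P_J_eq_J` (`PJ = J`), ★ `norm_rot_sq` (`R(θ)` is norm preserving), `rot_J`
  (`R(θ)J u = cos θ·Ju − sin θ·Pu`), ★ `norm_rot_deriv_sq` (`‖R(θ)g + s·R(θ)Ju‖² = ‖g + s·Ju‖²` — the rotated energy
  density is a translate), `norm_add_smul_sq`, `norm_J_le` (`‖Jz‖ ≤ ‖z‖`, Bessel);
* §2 `fderiv_sin_const_mul`, `fderiv_cos_const_mul_sub_one` — the chain rule for the angle `x ↦ t·ζ(x)`.
HONEST SCOPE.  Linear algebra and one-variable calculus; nothing of (RS), (C), S1″, K1, `MeanDeviationL`, `BlockLipschitzL`,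
`HistoryTailL` is proved here; YM₃ on T³ is rung R3, not Clay; YM gap NOT proved; no summit statement is proved here. [folklore]
-/

set_option autoImplicit false

noncomputable section

open scoped RealInnerProductSpace

namespace Summit.QuantumFields.YangMills.Theorems.PoincareLipschitzMinimiserWeaklyHarmonicLetters

variable {F : Type*} [NormedAddCommGroup F] [InnerProductSpace ℝ F]

/-! ## §1 Pointwise algebra of the plane rotation `R(θ) = 1 + sin θ·J + (cos θ − 1)·P` -/

/-- `J(Jz) = −Pz` for `J z = ⟪p,z⟫q − ⟪q,z⟫p`, `P z = ⟪p,z⟫p + ⟪q,z⟫q`, `p ⊥ q` unit. [folklore] -/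
theorem J_J_eq_neg_P {p q : F} (hp : ‖p‖ = 1) (hq : ‖q‖ = 1) (hpq : ⟪p, q⟫ = 0)
    {J P : F →L[ℝ] F} (hJ : ∀ z, J z = ⟪p, z⟫ • q - ⟪q, z⟫ • p) (hP : ∀ z, P z = ⟪p, z⟫ • p + ⟪q, z⟫ • q)
    (z : F) : J (J z) = -P z := by
  have hpp : ⟪p, p⟫ = 1 := by rw [real_inner_self_eq_norm_sq, hp, one_pow]
  have hqq : ⟪q, q⟫ = 1 := by rw [real_inner_self_eq_norm_sq, hq, one_pow]
  have hqp : ⟪q, p⟫ = 0 := by rw [real_inner_comm]; exact hpq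
  rw [hJ (J z), hJ z, hP z]
  simp only [inner_sub_right, real_inner_smul_right, hpp, hqq, hpq, hqp, mul_one, mul_zero, sub_zero, zero_sub]
  module

/-- `P(Jz) = Jz` (the rotation generator `J` maps into the plane `range P`). [folklore] -/
theorem P_J_eq_J {p q : F} (hp : ‖p‖ = 1) (hq : ‖q‖ = 1) (hpq : ⟪p, q⟫ = 0)
    {J P : F →L[ℝ] F} (hJ : ∀ z, J z = ⟪p, z⟫ • q - ⟪q, z⟫ • p) (hP : ∀ z, P z = ⟪p, z⟫ • p + ⟪q, z⟫ • q)
    (z : F) : P (J z) = J z := by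
  have hpp : ⟪p, p⟫ = 1 := by rw [real_inner_self_eq_norm_sq, hp, one_pow]
  have hqq : ⟪q, q⟫ = 1 := by rw [real_inner_self_eq_norm_sq, hq, one_pow]
  have hqp : ⟪q, p⟫ = 0 := by rw [real_inner_comm]; exact hpq
  rw [hP (J z), hJ z]
  simp only [inner_sub_right, real_inner_smul_right, hpp, hqq, hpq, hqp, mul_one, mul_zero, sub_zero, zero_sub]
  module

/-- ★ **`R(θ)` IS NORM PRESERVING**: `‖z + sin θ • J z + (cos θ − 1) • P z‖² = ‖z‖²`. [folklore] -/
theorem norm_rot_sq {p q : F} (hp : ‖p‖ = 1) (hq : ‖q‖ = 1) (hpq : ⟪p, q⟫ = 0)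
    {J P : F →L[ℝ] F} (hJ : ∀ z, J z = ⟪p, z⟫ • q - ⟪q, z⟫ • p) (hP : ∀ z, P z = ⟪p, z⟫ • p + ⟪q, z⟫ • q)
    (θ : ℝ) (z : F) : ‖z + Real.sin θ • J z + (Real.cos θ - 1) • P z‖ ^ 2 = ‖z‖ ^ 2 := by
  have hpp : ⟪p, p⟫ = 1 := by rw [real_inner_self_eq_norm_sq, hp, one_pow]
  have hqq : ⟪q, q⟫ = 1 := by rw [real_inner_self_eq_norm_sq, hq, one_pow]
  have hqp : ⟪q, p⟫ = 0 := by rw [real_inner_comm]; exact hpq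
  rw [← real_inner_self_eq_norm_sq, ← real_inner_self_eq_norm_sq, hJ z, hP z]
  simp only [inner_add_left, inner_add_right, inner_sub_left, inner_sub_right, real_inner_smul_left,
    real_inner_smul_right, hpp, hqq, hpq, hqp, real_inner_comm p z, real_inner_comm q z]
  linear_combination (⟪p, z⟫ ^ 2 + ⟪q, z⟫ ^ 2) * Real.sin_sq_add_cos_sq θ

/-- `R(θ)(J u) = cos θ • J u − sin θ • P u`. [folklore] -/
theorem rot_J {p q : F} (hp : ‖p‖ = 1) (hq : ‖q‖ = 1) (hpq : ⟪p, q⟫ = 0)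
    {J P : F →L[ℝ] F} (hJ : ∀ z, J z = ⟪p, z⟫ • q - ⟪q, z⟫ • p) (hP : ∀ z, P z = ⟪p, z⟫ • p + ⟪q, z⟫ • q)
    (θ : ℝ) (u : F) :
    J u + Real.sin θ • J (J u) + (Real.cos θ - 1) • P (J u) = Real.cos θ • J u - Real.sin θ • P u := by
  rw [J_J_eq_neg_P hp hq hpq hJ hP, P_J_eq_J hp hq hpq hJ hP]
  module

/-- ★ **THE ROTATED DENSITY IS THE TRANSLATED DENSITY**: `‖R(θ)g + s • R(θ)(Ju)‖² = ‖g + s • Ju‖²`, with `R(θ)(Ju)`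
in the form `cos θ • Ju − sin θ • Pu` in which it appears in the product rule. [folklore] -/
theorem norm_rot_deriv_sq {p q : F} (hp : ‖p‖ = 1) (hq : ‖q‖ = 1) (hpq : ⟪p, q⟫ = 0)
    {J P : F →L[ℝ] F} (hJ : ∀ z, J z = ⟪p, z⟫ • q - ⟪q, z⟫ • p) (hP : ∀ z, P z = ⟪p, z⟫ • p + ⟪q, z⟫ • q)
    (θ s : ℝ) (g u : F) :
    ‖(g + Real.sin θ • J g + (Real.cos θ - 1) • P g) + s • (Real.cos θ • J u - Real.sin θ • P u)‖ ^ 2 =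
      ‖g + s • J u‖ ^ 2 := by
  have key : (g + Real.sin θ • J g + (Real.cos θ - 1) • P g) + s • (Real.cos θ • J u - Real.sin θ • P u) =
      (g + s • J u) + Real.sin θ • J (g + s • J u) + (Real.cos θ - 1) • P (g + s • J u) := by
    rw [← rot_J hp hq hpq hJ hP θ u, map_add, map_smul, map_add, map_smul]
    module
  rw [key, norm_rot_sq hp hq hpq hJ hP]

/-- `‖g + s • w‖² = ‖g‖² + 2 s ⟪g, w⟫ + s² ‖w‖²`. [folklore] -/
theorem norm_add_smul_sq (g w : F) (s : ℝ) :
    ‖g + s • w‖ ^ 2 = ‖g‖ ^ 2 + 2 * s * ⟪g, w⟫ + s ^ 2 * ‖w‖ ^ 2 := by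
  rw [norm_add_sq_real, real_inner_smul_right, norm_smul, mul_pow, Real.norm_eq_abs, sq_abs]
  ring

/-- `‖J z‖ ≤ ‖z‖` (Bessel for the orthonormal pair `p, q`: `‖Jz‖² = ⟪p,z⟫² + ⟪q,z⟫² = ‖Pz‖² = ‖z‖² − ‖z − Pz‖²`). [folklore] -/
theorem norm_J_le {p q : F} (hp : ‖p‖ = 1) (hq : ‖q‖ = 1) (hpq : ⟪p, q⟫ = 0)
    {J : F →L[ℝ] F} (hJ : ∀ z, J z = ⟪p, z⟫ • q - ⟪q, z⟫ • p) (z : F) : ‖J z‖ ≤ ‖z‖ := by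
  have hpp : ⟪p, p⟫ = 1 := by rw [real_inner_self_eq_norm_sq, hp, one_pow]
  have hqq : ⟪q, q⟫ = 1 := by rw [real_inner_self_eq_norm_sq, hq, one_pow]
  have hqp : ⟪q, p⟫ = 0 := by rw [real_inner_comm]; exact hpq
  have h1 : ‖J z‖ ^ 2 = ⟪p, z⟫ ^ 2 + ⟪q, z⟫ ^ 2 := by
    rw [← real_inner_self_eq_norm_sq, hJ z]
    simp only [inner_sub_left, inner_sub_right, real_inner_smul_left, real_inner_smul_right, hpp, hqq, hpq, hqp]
    ring
  have h2 : ‖z - (⟪p, z⟫ • p + ⟪q, z⟫ • q)‖ ^ 2 = ‖z‖ ^ 2 - (⟪p, z⟫ ^ 2 + ⟪q, z⟫ ^ 2) := by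
    rw [← real_inner_self_eq_norm_sq, ← real_inner_self_eq_norm_sq]
    simp only [inner_add_left, inner_add_right, inner_sub_left, inner_sub_right, real_inner_smul_left,
      real_inner_smul_right, hpp, hqq, hpq, hqp, real_inner_comm p z, real_inner_comm q z]
    ring
  have h3 : ‖J z‖ ^ 2 ≤ ‖z‖ ^ 2 := by nlinarith [sq_nonneg ‖z - (⟪p, z⟫ • p + ⟪q, z⟫ • q)‖]
  exact (pow_le_pow_iff_left₀ (norm_nonneg _) (norm_nonneg _) two_ne_zero).1 h3

/-! ## §2 Calculus of the rotation angle `x ↦ t·ζ(x)` -/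

/-- `∂_v sin(t ζ) = t cos(t ζ) ∂_v ζ`. [folklore] -/
theorem fderiv_sin_const_mul {E : Type*} [NormedAddCommGroup E] [NormedSpace ℝ E] {ζ : E → ℝ}
    (hζ : Differentiable ℝ ζ) (t : ℝ) (x v : E) :
    fderiv ℝ (fun x => Real.sin (t * ζ x)) x v = t * Real.cos (t * ζ x) * fderiv ℝ ζ x v := by
  have h1 : HasFDerivAt (fun x => t * ζ x) (t • fderiv ℝ ζ x) x := (hζ x).hasFDerivAt.const_mul t
  have h2 : HasFDerivAt (Real.sin ∘ fun x => t * ζ x) (Real.cos (t * ζ x) • (t • fderiv ℝ ζ x)) x :=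
    (Real.hasDerivAt_sin (t * ζ x)).comp_hasFDerivAt x h1
  have h3 : (fun x => Real.sin (t * ζ x)) = Real.sin ∘ fun x => t * ζ x := rfl
  rw [h3, h2.fderiv]
  simp only [smul_apply, smul_eq_mul]
  ring

/-- `∂_v (cos(t ζ) − 1) = −t sin(t ζ) ∂_v ζ`. [folklore] -/
theorem fderiv_cos_const_mul_sub_one {E : Type*} [NormedAddCommGroup E] [NormedSpace ℝ E] {ζ : E → ℝ}
    (hζ : Differentiable ℝ ζ) (t : ℝ) (x v : E) :
    fderiv ℝ (fun x => Real.cos (t * ζ x) - 1) x v = -(t * Real.sin (t * ζ x)) * fderiv ℝ ζ x v := by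
  have h1 : HasFDerivAt (fun x => t * ζ x) (t • fderiv ℝ ζ x) x := (hζ x).hasFDerivAt.const_mul t
  have h2 : HasFDerivAt (Real.cos ∘ fun x => t * ζ x) (-Real.sin (t * ζ x) • (t • fderiv ℝ ζ x)) x :=
    (Real.hasDerivAt_cos (t * ζ x)).comp_hasFDerivAt x h1
  have h3 : HasFDerivAt (fun x => Real.cos (t * ζ x) - 1) (-Real.sin (t * ζ x) • (t • fderiv ℝ ζ x)) x :=
    h2.sub_const 1
  rw [h3.fderiv]
  simp only [smul_apply, smul_eq_mul]
  ring

end Summit.QuantumFields.YangMills.Theorems.PoincareLipschitzMinimiserWeaklyHarmonicLetters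

end
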